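import Mathlib
import HarnessLib

/-!
# Composing admissible reparametrisations of the fibre line

(Line `janus-bands`, crux `ArrangementNormalForm`, stub `stub_separateTwo`, part `Compose`.)
The hypotheses of the fibre-mass comparison lemmas (`SepTwo.lmass_comp_le`,
`SepTwo.lmass_comp_le_gain`, `SepTwo.setLIntegral_le_lmass_comp`) are stable under composition:
if `ψ₁` is admissible with constant `M₁` for the letter values `Γ` and `ψ₂` is admissible with
constant `M₂` for the letter values `ψ₁ '' Γ`, then `ψ₂ ∘ ψ₁` is admissible with constant
`M₁ M₂` for `Γ`, with derivative `ψ₂'(ψ₁ x) ψ₁'(x)` off the finite set `B₁ ∪ ψ₁⁻¹(B₂)`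
(`separateTwo_compose`). Hence a product of window contractions (part `Window`) and local shifts
(part `Shift`) with disjoint windows is ONE admissible map — the form in which the lower
comparison on sub-cells and the comparison with per-fibre gain (part `ComparisonGain`) consume
the multi-cluster moves of parts `Generic` / `Contract` (roadmap of `stub_separateTwo`, case of a
touching vertex on a degenerating polar edge).
-/

noncomputable section

open Set

namespace Summit.KontsevichZagierPeriods.ArrangementNormalForm.JanusBands

namespace SepTwo

/-- The exceptional set of a composition: `B₁ ∪ ψ₁⁻¹(B₂)` (finite by injectivity). -/
def compB (ψ₁ : ℝ → ℝ) (h : Function.Injective ψ₁) (B₁ B₂ : Finset ℝ) : Finset ℝ :=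
  B₁ ∪ B₂.preimage ψ₁ (h.injOn)

/-- Off the exceptional set of the composition, `x ∉ B₁` and `ψ₁ x ∉ B₂`. -/
theorem not_mem_of_not_mem_compB {ψ₁ : ℝ → ℝ} (h : Function.Injective ψ₁) {B₁ B₂ : Finset ℝ}
    {x : ℝ} (hx : x ∉ (compB ψ₁ h B₁ B₂ : Set ℝ)) :
    x ∉ (B₁ : Set ℝ) ∧ ψ₁ x ∉ (B₂ : Set ℝ) := by
  simp only [compB, Finset.coe_union, Finset.coe_preimage, mem_union, Finset.mem_coe,
    mem_preimage, not_or] at hx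
  exact ⟨fun h1 => hx.1 h1, fun h2 => hx.2 h2⟩

/-- **Composition of admissible reparametrisations.** See the module docstring. -/
theorem comp_admissible {ψ₁ ψ₁' ψ₂ ψ₂' : ℝ → ℝ} {B₁ B₂ : Finset ℝ} {M₁ M₂ : ℝ} (Γ : Set ℝ)
    (hM₁ : 0 ≤ M₁) (h1mono : StrictMono ψ₁) (h1surj : Function.Surjective ψ₁)
    (h1der : ∀ x, x ∉ (B₁ : Set ℝ) → HasDerivAt ψ₁ (ψ₁' x) x) (h1nn : ∀ x, 0 ≤ ψ₁' x)
    (h1bd : ∀ x, ψ₁' x ≤ M₁)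
    (h1rat : ∀ x, x ∉ (B₁ : Set ℝ) → ∀ γ ∈ Γ, ψ₁' x * |x - γ| ≤ M₁ * |ψ₁ x - ψ₁ γ|)
    (h2mono : StrictMono ψ₂) (h2surj : Function.Surjective ψ₂)
    (h2der : ∀ y, y ∉ (B₂ : Set ℝ) → HasDerivAt ψ₂ (ψ₂' y) y) (h2nn : ∀ y, 0 ≤ ψ₂' y)
    (h2bd : ∀ y, ψ₂' y ≤ M₂)
    (h2rat : ∀ y, y ∉ (B₂ : Set ℝ) → ∀ γ ∈ ψ₁ '' Γ, ψ₂' y * |y - γ| ≤ M₂ * |ψ₂ y - ψ₂ γ|) :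
    StrictMono (ψ₂ ∘ ψ₁) ∧ Function.Surjective (ψ₂ ∘ ψ₁) ∧
    (∀ x, x ∉ (compB ψ₁ h1mono.injective B₁ B₂ : Set ℝ) →
      HasDerivAt (ψ₂ ∘ ψ₁) (ψ₂' (ψ₁ x) * ψ₁' x) x) ∧
    (∀ x, 0 ≤ ψ₂' (ψ₁ x) * ψ₁' x ∧ ψ₂' (ψ₁ x) * ψ₁' x ≤ M₁ * M₂) ∧
    (∀ x, x ∉ (compB ψ₁ h1mono.injective B₁ B₂ : Set ℝ) → ∀ γ ∈ Γ,
      ψ₂' (ψ₁ x) * ψ₁' x * |x - γ| ≤ M₁ * M₂ * |(ψ₂ ∘ ψ₁) x - (ψ₂ ∘ ψ₁) γ|) := by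
  refine ⟨h2mono.comp h1mono, h2surj.comp h1surj, fun x hx => ?_, fun x => ?_, fun x hx γ hγ => ?_⟩
  · obtain ⟨hx1, hx2⟩ := not_mem_of_not_mem_compB h1mono.injective hx
    exact (h2der _ hx2).comp x (h1der x hx1)
  · refine ⟨mul_nonneg (h2nn _) (h1nn _), ?_⟩
    calc ψ₂' (ψ₁ x) * ψ₁' x ≤ M₂ * M₁ :=
          mul_le_mul (h2bd _) (h1bd _) (h1nn _) ((h2nn (ψ₁ x)).trans (h2bd _))
      _ = M₁ * M₂ := mul_comm _ _
  · obtain ⟨hx1, hx2⟩ := not_mem_of_not_mem_compB h1mono.injective hx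
    have r1 := h1rat x hx1 γ hγ
    have r2 := h2rat (ψ₁ x) hx2 (ψ₁ γ) (mem_image_of_mem ψ₁ hγ)
    have hM₂ : 0 ≤ M₂ := (h2nn (ψ₁ x)).trans (h2bd _)
    calc ψ₂' (ψ₁ x) * ψ₁' x * |x - γ| = ψ₂' (ψ₁ x) * (ψ₁' x * |x - γ|) := by ring
      _ ≤ ψ₂' (ψ₁ x) * (M₁ * |ψ₁ x - ψ₁ γ|) := mul_le_mul_of_nonneg_left r1 (h2nn _)
      _ = M₁ * (ψ₂' (ψ₁ x) * |ψ₁ x - ψ₁ γ|) := by ring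
      _ ≤ M₁ * (M₂ * |ψ₂ (ψ₁ x) - ψ₂ (ψ₁ γ)|) := mul_le_mul_of_nonneg_left r2 hM₁
      _ = M₁ * M₂ * |(ψ₂ ∘ ψ₁) x - (ψ₂ ∘ ψ₁) γ| := by simp [mul_assoc]

end SepTwo

/-- **Composition of admissible reparametrisations of the fibre line** (registered sub-goal of
`stub_separateTwo`; literal form of `SepTwo.comp_admissible` with the exceptional set spelled
out as `B₁ ∪ ψ₁⁻¹(B₂)`). -/
theorem separateTwo_compose (ψ₁ ψ₁' ψ₂ ψ₂' : ℝ → ℝ) (B₁ B₂ : Finset ℝ) (M₁ M₂ : ℝ) (Γ : Set ℝ) (hM₁ : 0 ≤ M₁) (h1mono : StrictMono ψ₁) (h1surj : Function.Surjective ψ₁) (h1der : ∀ x, x ∉ (B₁ : Set ℝ) → HasDerivAt ψ₁ (ψ₁' x) x) (h1nn : ∀ x, 0 ≤ ψ₁' x) (h1bd : ∀ x, ψ₁' x ≤ M₁) (h1rat : ∀ x, x ∉ (B₁ : Set ℝ) → ∀ γ ∈ Γ, ψ₁' x * |x - γ| ≤ M₁ * |ψ₁ x - ψ₁ γ|) (h2mono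 : StrictMono ψ₂) (h2surj : Function.Surjective ψ₂) (h2der : ∀ y, y ∉ (B₂ : Set ℝ) → HasDerivAt ψ₂ (ψ₂' y) y) (h2nn : ∀ y, 0 ≤ ψ₂' y) (h2bd : ∀ y, ψ₂' y ≤ M₂) (h2rat : ∀ y, y ∉ (B₂ : Set ℝ) → ∀ γ ∈ ψ₁ '' Γ, ψ₂' y * |y - γ| ≤ M₂ * |ψ₂ y - ψ₂ γ|) : ∃ B : Finset ℝ, (∀ x, x ∈ B ↔ x ∈ B₁ ∨ ψ₁ x ∈ B₂) ∧ StrictMono (ψ₂ ∘ ψ₁) ∧ Function.Surjective (ψ₂ ∘ ψ₁) ∧ (∀ x, x ∉ (B : Set ℝ) → HasDerivAt (ψ₂ ∘ ψ₁) (ψ₂' (ψ₁ x) * ψ₁' x) x) ∧ (∀ x, 0 ≤ ψ₂' (ψ₁ x) * ψ₁' x ∧ ψ₂' (ψ₁ x) * ψ₁' x ≤ M₁ * M₂) ∧ (∀ x, x ∉ (B : Set ℝ) → ∀ γ ∈ Γ, ψ₂' (ψ₁ x) * ψ₁' x * |x - γ| ≤ M₁ * M₂ * |(ψ₂ ∘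 ψ₁) x - (ψ₂ ∘ ψ₁) γ|) := by
  obtain ⟨h1, h2, h3, h4, h5⟩ := SepTwo.comp_admissible Γ hM₁ h1mono h1surj h1der h1nn h1bd h1rat
    h2mono h2surj h2der h2nn h2bd h2rat
  refine ⟨SepTwo.compB ψ₁ h1mono.injective B₁ B₂, fun x => ?_, h1, h2, h3, h4, h5⟩
  simp [SepTwo.compB]

end Summit.KontsevichZagierPeriods.ArrangementNormalForm.JanusBands
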